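import Literature.AlgebraicGeometry.Frobenioids.Cor54RigidityLinearTransport
import Literature.AlgebraicGeometry.Frobenioids.ModelFrobenioidFunctorIso
import HarnessLib

/-!
# Frobenioids I, Corollary 5.4 (strong 1-uniqueness at THE data): the divisor cocycle of a functorial
# self-map on identity-base linear morphisms (sub-DAG row C54-core-arith, sub-row (4), file 4b-II, generic)

Mochizuki, *The geometry of Frobenioids I: the general theory*, Kyushu J. Math. **62** (2008) 293–400,
Corollary 5.4, kurims p. 104 ll. 1–9; model Frobenioids Thm. 5.2 (i) p. 100; Prop. 5.3 p. 103.
[cite: MochizukiFrdI2008, Cor. 5.4 p.104] [cite: MochizukiFrdI2008, Thm. 5.2(i) p.100]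

PROOF-ONLY file (cell abc-iut, seat abc-iut-L1-d8; sub-row (4) of row C54-core-arith, requested by the final-file
holder abc-iut-L1-d9; no definitions). Setting of `Cor54RigidityLinearReduction.lean` / `…Transport.lean`:
`G = h.functor` for a morphism of model data `h` (e.g. `untrToRlf`), `ρ` a functorial self-map of the homs between
`G`-image objects fixing the `G f`, identity-base linear `k = (1, 𝟙_A, z, u) : G(A, γ) → G(A, γ')`. Once `ρ(k) =
(1, 𝟙_A, ẑ, û)` is identity-base linear too (hypothesis `hB1`, established at `C_{K/F}` in the final file), the
"divisor cocycle" `δ(k) := ẑ - z ∈ Φ'(A)^gp` controls `ρ`; its formal properties, in cross-multiplied form: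
(c3) `of_div_rho_mul_divB_eq`: `ẑ - z = Div_B'(û) - Div_B'(u)`; (c1) `rho_comp_linear`: `δ` is additive under
composition; (c2) `rho_map_linear`: `δ = 0` on images; (c4) `div_rho_eq_of_div_eq_of_unit_eq`: `ẑ` depends only
on `(z, u)`, not on the source class (common translates, `η^gp` injective); (c4′) `delta_eq_of_unit_eq`: `δ(k)`
depends only on `u`; (c5) `exists_pow_unit`: for `n ≥ 1` an identity-base linear `K_n` out of `G(A, γ)` with
unit coordinate `u^n` and `δ(K_n) = n · δ(k)`.
Pure model-Frobenioid algebra; nothing here bears on [IUTchIII] Cor. 3.12.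
-/

noncomputable section

namespace Literature.AlgebraicGeometry.Frobenioids

open CategoryTheory Opposite

universe w v u

namespace ModelFrobenioid.DataHom
variable {D : Type u} [Category.{v} D] {Φ B Φ' B' : Dᵒᵖ ⥤ CommMonCat.{w}} {DivB : B ⟶ monoidGp Φ}
  {DivB' : B' ⟶ monoidGp Φ'} (h : DataHom DivB DivB')

/-- Relation (d) of Thm. 5.2 (i) for an identity-base linear morphism `m = (1, 𝟙_A, z, u) : G(A, γ) → G(A, γ')`
between image objects, in `Φ'(A)^gp`: `η^gp(γ) · z = η^gp(γ') · Div_B'(u)`. [cite: MochizukiFrdI2008, Thm. 5.2(i) p.100] -/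
theorem rel_linear (A : D) (γ γ' : Algebra.GrothendieckGroup (Φ.obj (op A)))
    (m : h.functor.obj ⟨A, γ⟩ ⟶ h.functor.obj ⟨A, γ'⟩) (hd : degFr m = 1) (hb : baseMap m = 𝟙 A)
    (z : Φ'.obj (op A)) (uu : B'.obj (op A)) (hz : div m = z) (hu : unit m = uu) :
    gpApp h.η (op A) γ * Algebra.GrothendieckGroup.of z = gpApp h.η (op A) γ' * divB Φ' B' DivB' (op A) uu := by
  obtain ⟨d, f, z₁, u₁, hrel⟩ := m
  change ℕ+ at d
  change A ⟶ A at f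
  change ↥(Φ'.obj (op A)) at z₁
  change ↥(B'.obj (op A)) at u₁
  change d = 1 at hd
  change f = 𝟙 A at hb
  change z₁ = z at hz
  change u₁ = uu at hu
  subst hd hb hz hu
  have hr : (gpApp h.η (op A) γ) ^ ((1 : ℕ+) : ℕ) * Algebra.GrothendieckGroup.of z₁ =
      pullGp Φ' (𝟙 A) (gpApp h.η (op A) γ') * divB Φ' B' DivB' (op A) u₁ := hrel
  rw [PNat.one_coe, pow_one, pullGp_id] at hr
  exact hr

/-- **(c3) The divisor cocycle lies in the image of `B'`.** If `k = (1, 𝟙_A, z, u)` and `ρ(k) = (1, 𝟙_A, ẑ, û)` are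
both identity-base linear morphisms `G(A, γ) → G(A, γ')`, then `ẑ + Div_B'(u) = z + Div_B'(û)` in `Φ'(A)^gp`
(subtract the two relations (d)). [cite: MochizukiFrdI2008, Thm. 5.2(i) p.100] -/
theorem of_div_rho_mul_divB_eq (A : D) (γ γ' : Algebra.GrothendieckGroup (Φ.obj (op A)))
    (k k' : h.functor.obj ⟨A, γ⟩ ⟶ h.functor.obj ⟨A, γ'⟩)
    (hd : degFr k = 1) (hb : baseMap k = 𝟙 A) (z : Φ'.obj (op A)) (uu : B'.obj (op A))
    (hz : div k = z) (hu : unit k = uu)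
    (hd' : degFr k' = 1) (hb' : baseMap k' = 𝟙 A) (z' : Φ'.obj (op A)) (u' : B'.obj (op A))
    (hz' : div k' = z') (hu' : unit k' = u') :
    Algebra.GrothendieckGroup.of z' * divB Φ' B' DivB' (op A) uu =
      Algebra.GrothendieckGroup.of z * divB Φ' B' DivB' (op A) u' := by
  have h1 := h.rel_linear A γ γ' k hd hb z uu hz hu
  have h2 := h.rel_linear A γ γ' k' hd' hb' z' u' hz' hu'
  have h3 : gpApp h.η (op A) γ * (Algebra.GrothendieckGroup.of z' * divB Φ' B' DivB' (op A) uu) =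
      gpApp h.η (op A) γ * (Algebra.GrothendieckGroup.of z * divB Φ' B' DivB' (op A) u') := by
    rw [← mul_assoc, h2, ← mul_assoc, h1, mul_assoc, mul_assoc, mul_comm (divB _ _ _ _ u')]
  exact mul_left_cancel h3

/-- **(c2) `ρ` fixes the image morphisms**: for `f = (1, 𝟙_A, w, v)` of the source model, `ρ(G f) = G f` has
components `(1, 𝟙_A, η(w), β(v))`. [cite: MochizukiFrdI2008, Prop. 5.3 p.103] -/
theorem rho_map_linear
    (ρ : ∀ ⦃a a' : ModelFrobenioid Φ B DivB⦄,
      (h.functor.obj a ⟶ h.functor.obj a') → (h.functor.obj a ⟶ h.functor.obj a'))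
    (hmap : ∀ ⦃a a' : ModelFrobenioid Φ B DivB⦄ (f : a ⟶ a'), ρ (h.functor.map f) = h.functor.map f)
    (A : D) (γ γ' : Algebra.GrothendieckGroup (Φ.obj (op A)))
    (f : (⟨A, γ⟩ : ModelFrobenioid Φ B DivB) ⟶ ⟨A, γ'⟩) (hd : degFr f = 1) (hb : baseMap f = 𝟙 A) :
    degFr (ρ (h.functor.map f)) = 1 ∧ baseMap (ρ (h.functor.map f)) = 𝟙 A ∧
      div (ρ (h.functor.map f)) = (h.η.app (op A)).hom (div f) ∧
      unit (ρ (h.functor.map f)) = (h.β.app (op A)).hom (unit f) := by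
  rw [hmap]
  exact ⟨hd, hb, rfl, rfl⟩

/-- **(c1) `ρ` on composites of identity-base linear morphisms.** If `k₁ = (1, 𝟙, z₁, u₁) : G(A, γ) → G(A, γ')` and
`k₂ = (1, 𝟙, z₂, u₂) : G(A, γ') → G(A, γ'')` have identity-base linear images `ρ(k_i) = (1, 𝟙, ẑ_i, û_i)`, then
`k₁ ≫ k₂ = (1, 𝟙, z₂ + z₁, u₂ + u₁)` and `ρ(k₁ ≫ k₂) = (1, 𝟙, ẑ₂ + ẑ₁, û₂ + û₁)` (functoriality of `ρ` and the
composition law of Thm. 5.2 (i)). [cite: MochizukiFrdI2008, Thm. 5.2(i) p.100] -/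
theorem rho_comp_linear
    (ρ : ∀ ⦃a a' : ModelFrobenioid Φ B DivB⦄,
      (h.functor.obj a ⟶ h.functor.obj a') → (h.functor.obj a ⟶ h.functor.obj a'))
    (hcomp : ∀ ⦃a a' a'' : ModelFrobenioid Φ B DivB⦄ (k : h.functor.obj a ⟶ h.functor.obj a')
      (l : h.functor.obj a' ⟶ h.functor.obj a''), ρ (k ≫ l) = ρ k ≫ ρ l)
    (A : D) (γ γ' γ'' : Algebra.GrothendieckGroup (Φ.obj (op A)))
    (k₁ : h.functor.obj ⟨A, γ⟩ ⟶ h.functor.obj ⟨A, γ'⟩) (k₂ : h.functor.obj ⟨A, γ'⟩ ⟶ h.functor.obj ⟨A, γ''⟩)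
    (z₁ z₂ z₁' z₂' : Φ'.obj (op A)) (u₁ u₂ u₁' u₂' : B'.obj (op A))
    (hd₁ : degFr k₁ = 1) (hb₁ : baseMap k₁ = 𝟙 A) (hz₁ : div k₁ = z₁) (hu₁ : unit k₁ = u₁)
    (hd₂ : degFr k₂ = 1) (hb₂ : baseMap k₂ = 𝟙 A) (hz₂ : div k₂ = z₂) (hu₂ : unit k₂ = u₂)
    (hρd₁ : degFr (ρ k₁) = 1) (hρb₁ : baseMap (ρ k₁) = 𝟙 A) (hρz₁ : div (ρ k₁) = z₁') (hρu₁ : unit (ρ k₁) = u₁')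
    (hρd₂ : degFr (ρ k₂) = 1) (hρb₂ : baseMap (ρ k₂) = 𝟙 A) (hρz₂ : div (ρ k₂) = z₂') (hρu₂ : unit (ρ k₂) = u₂') :
    (degFr (k₁ ≫ k₂) = 1 ∧ baseMap (k₁ ≫ k₂) = 𝟙 A ∧ div (k₁ ≫ k₂) = z₂ * z₁ ∧ unit (k₁ ≫ k₂) = u₂ * u₁) ∧
    (degFr (ρ (k₁ ≫ k₂)) = 1 ∧ baseMap (ρ (k₁ ≫ k₂)) = 𝟙 A ∧ div (ρ (k₁ ≫ k₂)) = z₂' * z₁' ∧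
      unit (ρ (k₁ ≫ k₂)) = u₂' * u₁') := by
  rw [hcomp]
  obtain ⟨d₁, f₁, a₁, b₁, hr₁⟩ := k₁
  obtain ⟨d₂, f₂, a₂, b₂, hr₂⟩ := k₂
  change ℕ+ at d₁ d₂
  change A ⟶ A at f₁ f₂
  change ↥(Φ'.obj (op A)) at a₁ a₂
  change ↥(B'.obj (op A)) at b₁ b₂
  change d₁ = 1 at hd₁
  change f₁ = 𝟙 A at hb₁
  change a₁ = z₁ at hz₁
  change b₁ = u₁ at hu₁
  change d₂ = 1 at hd₂
  change f₂ = 𝟙 A at hb₂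
  change a₂ = z₂ at hz₂
  change b₂ = u₂ at hu₂
  subst hd₁ hb₁ hz₁ hu₁ hd₂ hb₂ hz₂ hu₂
  set K₁ : h.functor.obj ⟨A, γ⟩ ⟶ h.functor.obj ⟨A, γ'⟩ :=
    (⟨1, 𝟙 A, a₁, b₁, hr₁⟩ : h.functor.obj ⟨A, γ⟩ ⟶ h.functor.obj ⟨A, γ'⟩) with hK₁
  set K₂ : h.functor.obj ⟨A, γ'⟩ ⟶ h.functor.obj ⟨A, γ''⟩ :=
    (⟨1, 𝟙 A, a₂, b₂, hr₂⟩ : h.functor.obj ⟨A, γ'⟩ ⟶ h.functor.obj ⟨A, γ''⟩) with hK₂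
  generalize hR₁ : ρ K₁ = r₁ at hρd₁ hρb₁ hρz₁ hρu₁
  generalize hR₂ : ρ K₂ = r₂ at hρd₂ hρb₂ hρz₂ hρu₂
  obtain ⟨e₁, g₁, c₁, v₁, hq₁⟩ := r₁
  obtain ⟨e₂, g₂, c₂, v₂, hq₂⟩ := r₂
  change ℕ+ at e₁ e₂
  change A ⟶ A at g₁ g₂
  change ↥(Φ'.obj (op A)) at c₁ c₂
  change ↥(B'.obj (op A)) at v₁ v₂
  change e₁ = 1 at hρd₁
  change g₁ = 𝟙 A at hρb₁
  change c₁ = z₁' at hρz₁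
  change v₁ = u₁' at hρu₁
  change e₂ = 1 at hρd₂
  change g₂ = 𝟙 A at hρb₂
  change c₂ = z₂' at hρz₂
  change v₂ = u₂' at hρu₂
  subst hρd₁ hρb₁ hρz₁ hρu₁ hρd₂ hρb₂ hρz₂ hρu₂
  refine ⟨⟨rfl, Category.id_comp _, ?_, ?_⟩, ⟨rfl, Category.id_comp _, ?_, ?_⟩⟩
  · show (Φ'.map (𝟙 A).op).hom a₂ * a₁ ^ ((1 : ℕ+) : ℕ) = a₂ * a₁
    rw [op_id, Φ'.map_id, CommMonCat.hom_id, MonoidHom.id_apply, PNat.one_coe, pow_one]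
  · show (B'.map (𝟙 A).op).hom b₂ * b₁ ^ ((1 : ℕ+) : ℕ) = b₂ * b₁
    rw [op_id, B'.map_id, CommMonCat.hom_id, MonoidHom.id_apply, PNat.one_coe, pow_one]
  · show (Φ'.map (𝟙 A).op).hom c₂ * c₁ ^ ((1 : ℕ+) : ℕ) = c₂ * c₁
    rw [op_id, Φ'.map_id, CommMonCat.hom_id, MonoidHom.id_apply, PNat.one_coe, pow_one]
  · show (B'.map (𝟙 A).op).hom v₂ * v₁ ^ ((1 : ℕ+) : ℕ) = v₂ * v₁
    rw [op_id, B'.map_id, CommMonCat.hom_id, MonoidHom.id_apply, PNat.one_coe, pow_one]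

/-- Equal components between equal objects give equal `Div(ρ ·)` (bookkeeping for (c4)).
[cite: MochizukiFrdI2008, Thm. 5.2(i) p.100] -/
theorem div_rho_eq_of_cls_eq
    (ρ : ∀ ⦃a a' : ModelFrobenioid Φ B DivB⦄,
      (h.functor.obj a ⟶ h.functor.obj a') → (h.functor.obj a ⟶ h.functor.obj a'))
    (A : D) (s s' t t' : Algebra.GrothendieckGroup (Φ.obj (op A))) (hs : s = s') (ht : t = t')
    (k : h.functor.obj ⟨A, s⟩ ⟶ h.functor.obj ⟨A, t⟩) (k' : h.functor.obj ⟨A, s'⟩ ⟶ h.functor.obj ⟨A, t'⟩)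
    (z : Φ'.obj (op A)) (uu : B'.obj (op A))
    (hd : degFr k = 1) (hb : baseMap k = 𝟙 A) (hz : div k = z) (hu : unit k = uu)
    (hd' : degFr k' = 1) (hb' : baseMap k' = 𝟙 A) (hz' : div k' = z) (hu' : unit k' = uu)
    (c c' : Φ'.obj (op A)) (hc : div (ρ k) = c) (hc' : div (ρ k') = c') : c = c' := by
  subst hs ht
  have hk : k = k' := by
    obtain ⟨d₁, f₁, a₁, b₁, hq₁⟩ := k
    obtain ⟨d₂, f₂, a₂, b₂, hq₂⟩ := k'
    change ℕ+ at d₁ d₂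
    change A ⟶ A at f₁ f₂
    change ↥(Φ'.obj (op A)) at a₁ a₂
    change ↥(B'.obj (op A)) at b₁ b₂
    change d₁ = 1 at hd
    change f₁ = 𝟙 A at hb
    change a₁ = z at hz
    change b₁ = uu at hu
    change d₂ = 1 at hd'
    change f₂ = 𝟙 A at hb'
    change a₂ = z at hz'
    change b₂ = uu at hu'
    subst hd hb hz hu hd' hb' hz' hu'
    rfl
  subst hk
  rw [← hc, ← hc']

/-- Every element of `Φ(A)^gp` is a quotient of two elements of `Φ(A)`. [cite: MochizukiFrdI2008, Thm. 5.2(i) p.100] -/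
theorem exists_eq_of_div_of (A : D) (q : Algebra.GrothendieckGroup (Φ.obj (op A))) :
    ∃ x y : Φ.obj (op A), q = Algebra.GrothendieckGroup.of x / Algebra.GrothendieckGroup.of y := by
  induction q using Localization.induction_on with
  | H p =>
    refine ⟨p.1, p.2, eq_div_iff_mul_eq'.mpr ?_⟩
    show Localization.mk p.1 p.2 * Localization.mk (p.2 : Φ.obj (op A)) 1 = Localization.mk p.1 1
    rw [Localization.mk_mul, Localization.mk_eq_mk_iff, Localization.r_iff_exists]
    exact ⟨1, by simp [mul_comm]⟩

/-- **(c4) The image divisor depends only on `(Div, u)`, not on the source class.** Suppose `ρ` maps every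
identity-base linear morphism between image objects over `A` to an identity-base linear morphism (`hB1`), `η^gp`
is injective at `A` and `Φ'(A)` is right-cancellative. If `k₁ : G(A, s₁) → G(A, t₁)` and `k₂ : G(A, s₂) → G(A, t₂)`
are identity-base linear with the same `Div = z` and the same `u`, then `Div(ρ k₁) = Div(ρ k₂)` (translate both
along image pre-steps to the common source class `s₁ + w₁ = s₂ + w₂`, `rho_translate_of_linear`; the targets then
agree by relation (d) and injectivity of `η^gp`). [cite: MochizukiFrdI2008, Cor. 5.4 p.104] -/
theorem div_rho_eq_of_div_eq_of_unit_eq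
    (ρ : ∀ ⦃a a' : ModelFrobenioid Φ B DivB⦄,
      (h.functor.obj a ⟶ h.functor.obj a') → (h.functor.obj a ⟶ h.functor.obj a'))
    (hcomp : ∀ ⦃a a' a'' : ModelFrobenioid Φ B DivB⦄ (k : h.functor.obj a ⟶ h.functor.obj a')
      (l : h.functor.obj a' ⟶ h.functor.obj a''), ρ (k ≫ l) = ρ k ≫ ρ l)
    (hmap : ∀ ⦃a a' : ModelFrobenioid Φ B DivB⦄ (f : a ⟶ a'), ρ (h.functor.map f) = h.functor.map f)
    (A : D) [IsRightCancelMul (Φ'.obj (op A))] (hι : Function.Injective (gpApp h.η (op A)))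
    (hB1 : ∀ (γ γ' : Algebra.GrothendieckGroup (Φ.obj (op A)))
      (k : h.functor.obj ⟨A, γ⟩ ⟶ h.functor.obj ⟨A, γ'⟩), degFr k = 1 → baseMap k = 𝟙 A →
        degFr (ρ k) = 1 ∧ baseMap (ρ k) = 𝟙 A)
    (s₁ t₁ s₂ t₂ : Algebra.GrothendieckGroup (Φ.obj (op A)))
    (k₁ : h.functor.obj ⟨A, s₁⟩ ⟶ h.functor.obj ⟨A, t₁⟩) (k₂ : h.functor.obj ⟨A, s₂⟩ ⟶ h.functor.obj ⟨A, t₂⟩)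
    (z : Φ'.obj (op A)) (uu : B'.obj (op A))
    (hd₁ : degFr k₁ = 1) (hb₁ : baseMap k₁ = 𝟙 A) (hz₁ : div k₁ = z) (hu₁ : unit k₁ = uu)
    (hd₂ : degFr k₂ = 1) (hb₂ : baseMap k₂ = 𝟙 A) (hz₂ : div k₂ = z) (hu₂ : unit k₂ = uu)
    (c₁ c₂ : Φ'.obj (op A)) (hc₁ : div (ρ k₁) = c₁) (hc₂ : div (ρ k₂) = c₂) : c₁ = c₂ := by
  obtain ⟨w₁, w₂, hq⟩ := exists_eq_of_div_of (Φ := Φ) A (s₂ * s₁⁻¹)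
  have hs : s₁ * Algebra.GrothendieckGroup.of w₁ = s₂ * Algebra.GrothendieckGroup.of w₂ := by
    rw [eq_div_iff_mul_eq'] at hq; rw [← hq, mul_assoc s₂, mul_left_comm s₁ s₂, mul_inv_cancel_left]
  obtain ⟨hρd₁, hρb₁⟩ := hB1 s₁ t₁ k₁ hd₁ hb₁
  obtain ⟨hρd₂, hρb₂⟩ := hB1 s₂ t₂ k₂ hd₂ hb₂
  obtain ⟨K₁, hK₁d, hK₁b, hK₁z, hK₁u, hK₁ρd, hK₁ρb, hK₁ρz, -⟩ :=
    h.rho_translate_of_linear A ρ hcomp hmap s₁ t₁ k₁ hd₁ hb₁ z uu hz₁ hu₁ c₁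
      (show B'.obj (op A) from unit (ρ k₁)) hρd₁ hρb₁ hc₁ rfl w₁
  obtain ⟨K₂, hK₂d, hK₂b, hK₂z, hK₂u, hK₂ρd, hK₂ρb, hK₂ρz, -⟩ :=
    h.rho_translate_of_linear A ρ hcomp hmap s₂ t₂ k₂ hd₂ hb₂ z uu hz₂ hu₂ c₂
      (show B'.obj (op A) from unit (ρ k₂)) hρd₂ hρb₂ hc₂ rfl w₂
  have hr₁ := h.rel_linear A _ _ K₁ hK₁d hK₁b z uu hK₁z hK₁u
  have hr₂ := h.rel_linear A _ _ K₂ hK₂d hK₂b z uu hK₂z hK₂u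
  have ht : t₁ * Algebra.GrothendieckGroup.of w₁ = t₂ * Algebra.GrothendieckGroup.of w₂ := by
    apply hι
    rw [hs] at hr₁
    exact mul_right_cancel (hr₁.symm.trans hr₂)
  exact h.div_rho_eq_of_cls_eq ρ A _ _ _ _ hs ht K₁ K₂ z uu hK₁d hK₁b hK₁z hK₁u hK₂d hK₂b hK₂z hK₂u c₁ c₂
    hK₁ρz hK₂ρz

/-- **(c4′) The divisor cocycle depends only on the unit coordinate.** Under the hypotheses of (c4) and with
`Φ'(A)` cancellative: if `k = (1, 𝟙, z, u) : G(A, γ) → G(A, γ')` and `k' = (1, 𝟙, z', u) : G(A, β) → G(A, β')` are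
identity-base linear with the SAME `u`, and `ρ(k) = (1, 𝟙, ẑ, ·)`, `ρ(k') = (1, 𝟙, ẑ', ·)`, then `ẑ - z = ẑ' - z'`
in `Φ'(A)^gp` (equalise the divisors by the image pre-steps `Z_e`, `Z_{e'}` with `z' + η(e') = z + η(e)`, then (c4)).
[cite: MochizukiFrdI2008, Cor. 5.4 p.104] -/
theorem delta_eq_of_unit_eq
    (ρ : ∀ ⦃a a' : ModelFrobenioid Φ B DivB⦄,
      (h.functor.obj a ⟶ h.functor.obj a') → (h.functor.obj a ⟶ h.functor.obj a'))
    (hcomp : ∀ ⦃a a' a'' : ModelFrobenioid Φ B DivB⦄ (k : h.functor.obj a ⟶ h.functor.obj a')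
      (l : h.functor.obj a' ⟶ h.functor.obj a''), ρ (k ≫ l) = ρ k ≫ ρ l)
    (hmap : ∀ ⦃a a' : ModelFrobenioid Φ B DivB⦄ (f : a ⟶ a'), ρ (h.functor.map f) = h.functor.map f)
    (A : D) [IsCancelMul (Φ'.obj (op A))] (hι : Function.Injective (gpApp h.η (op A)))
    (hB1 : ∀ (γ γ' : Algebra.GrothendieckGroup (Φ.obj (op A)))
      (k : h.functor.obj ⟨A, γ⟩ ⟶ h.functor.obj ⟨A, γ'⟩), degFr k = 1 → baseMap k = 𝟙 A →
        degFr (ρ k) = 1 ∧ baseMap (ρ k) = 𝟙 A)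
    (γ γ' β β' : Algebra.GrothendieckGroup (Φ.obj (op A)))
    (k : h.functor.obj ⟨A, γ⟩ ⟶ h.functor.obj ⟨A, γ'⟩) (k' : h.functor.obj ⟨A, β⟩ ⟶ h.functor.obj ⟨A, β'⟩)
    (z z' : Φ'.obj (op A)) (uu : B'.obj (op A))
    (hd : degFr k = 1) (hb : baseMap k = 𝟙 A) (hz : div k = z) (hu : unit k = uu)
    (hd' : degFr k' = 1) (hb' : baseMap k' = 𝟙 A) (hz' : div k' = z') (hu' : unit k' = uu)
    (c c' : Φ'.obj (op A)) (hc : div (ρ k) = c) (hc' : div (ρ k') = c') :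
    Algebra.GrothendieckGroup.of c * Algebra.GrothendieckGroup.of z' =
      Algebra.GrothendieckGroup.of c' * Algebra.GrothendieckGroup.of z := by
  have r1 := h.rel_linear A γ γ' k hd hb z uu hz hu
  have r2 := h.rel_linear A β β' k' hd' hb' z' uu hz' hu'
  set ι := gpApp h.η (op A) with hιdef
  set ū := divB Φ' B' DivB' (op A) uu with hūdef
  have hz1 : Algebra.GrothendieckGroup.of z = (ι γ)⁻¹ * (ι γ' * ū) := eq_inv_mul_of_mul_eq r1
  have hz2 : Algebra.GrothendieckGroup.of z' = (ι β)⁻¹ * (ι β' * ū) := eq_inv_mul_of_mul_eq r2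
  obtain ⟨e, e', hq⟩ := exists_eq_of_div_of (Φ := Φ) A (β⁻¹ * β' * (γ⁻¹ * γ')⁻¹)
  have hιq : ι (β⁻¹ * β' * (γ⁻¹ * γ')⁻¹) = (ι β)⁻¹ * ι β' * ((ι γ)⁻¹ * ι γ')⁻¹ := by
    simp only [map_mul, map_inv]
  have hzq : Algebra.GrothendieckGroup.of z' =
      ι (β⁻¹ * β' * (γ⁻¹ * γ')⁻¹) * Algebra.GrothendieckGroup.of z := by
    rw [hιq, hz1, hz2, ← mul_assoc (ι γ)⁻¹ _ ū, mul_assoc ((ι β)⁻¹ * ι β'), inv_mul_cancel_left, mul_assoc]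
  have E0 : Algebra.GrothendieckGroup.of z' * ι (Algebra.GrothendieckGroup.of e') =
      Algebra.GrothendieckGroup.of z * ι (Algebra.GrothendieckGroup.of e) := by
    rw [eq_div_iff_mul_eq'] at hq
    have hq' : ι (β⁻¹ * β' * (γ⁻¹ * γ')⁻¹) * ι (Algebra.GrothendieckGroup.of e') =
        ι (Algebra.GrothendieckGroup.of e) := by rw [← map_mul, hq]
    rw [← hq', hzq]
    ac_rfl
  have E1 : Algebra.GrothendieckGroup.of (z' * (h.η.app (op A)).hom e') =
      Algebra.GrothendieckGroup.of (z * (h.η.app (op A)).hom e) := by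
    rw [map_mul, map_mul, ← gpApp_of, ← gpApp_of]
    exact E0
  have hzz : z' * (h.η.app (op A)).hom e' = z * (h.η.app (op A)).hom e :=
    Algebra.GrothendieckGroup.of_injective E1
  let Ze : (⟨A, γ'⟩ : ModelFrobenioid Φ B DivB) ⟶ ⟨A, γ' * Algebra.GrothendieckGroup.of e⟩ :=
    ⟨1, 𝟙 A, e, 1, by rw [PNat.one_coe, pow_one, map_one, mul_one, pullGp_id]⟩
  let Ze' : (⟨A, β'⟩ : ModelFrobenioid Φ B DivB) ⟶ ⟨A, β' * Algebra.GrothendieckGroup.of e'⟩ :=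
    ⟨1, 𝟙 A, e', 1, by rw [PNat.one_coe, pow_one, map_one, mul_one, pullGp_id]⟩
  obtain ⟨hGd, hGb, hGz, hGu⟩ := h.rho_map_linear ρ hmap A _ _ Ze rfl rfl
  obtain ⟨hGd', hGb', hGz', hGu'⟩ := h.rho_map_linear ρ hmap A _ _ Ze' rfl rfl
  have hGu1 : unit (ρ (h.functor.map Ze)) = 1 := hGu.trans (map_one _)
  have hGu1' : unit (ρ (h.functor.map Ze')) = 1 := hGu'.trans (map_one _)
  obtain ⟨hρd, hρb⟩ := hB1 γ γ' k hd hb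
  obtain ⟨hρd', hρb'⟩ := hB1 β β' k' hd' hb'
  obtain ⟨⟨hKd, hKb, hKz, hKu⟩, ⟨hρKd, hρKb, hρKz, hρKu⟩⟩ := h.rho_comp_linear ρ hcomp A γ γ' _ k
    (h.functor.map Ze) z ((h.η.app (op A)).hom e) c ((h.η.app (op A)).hom e) uu 1
    (show B'.obj (op A) from unit (ρ k)) 1 hd hb hz hu rfl rfl rfl (map_one _) hρd hρb hc rfl hGd hGb hGz hGu1
  obtain ⟨⟨hKd', hKb', hKz', hKu'⟩, ⟨hρKd', hρKb', hρKz', hρKu'⟩⟩ := h.rho_comp_linear ρ hcomp A β β' _ k'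
    (h.functor.map Ze') z' ((h.η.app (op A)).hom e') c' ((h.η.app (op A)).hom e') uu 1
    (show B'.obj (op A) from unit (ρ k')) 1 hd' hb' hz' hu' rfl rfl rfl (map_one _) hρd' hρb' hc' rfl
    hGd' hGb' hGz' hGu1'
  have hKz'' : div (k' ≫ h.functor.map Ze') = (h.η.app (op A)).hom e * z := by
    rw [hKz', mul_comm, hzz, mul_comm]
  have h5 := h.div_rho_eq_of_div_eq_of_unit_eq ρ hcomp hmap A hι hB1 _ _ _ _ (k ≫ h.functor.map Ze)
    (k' ≫ h.functor.map Ze') ((h.η.app (op A)).hom e * z) (1 * uu) hKd hKb hKz hKu hKd' hKb' hKz'' hKu'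
    _ _ hρKz hρKz'
  have A1 : Algebra.GrothendieckGroup.of ((h.η.app (op A)).hom e) * Algebra.GrothendieckGroup.of c =
      Algebra.GrothendieckGroup.of ((h.η.app (op A)).hom e') * Algebra.GrothendieckGroup.of c' := by
    rw [← map_mul, ← map_mul, h5]
  have A2 : Algebra.GrothendieckGroup.of z' * Algebra.GrothendieckGroup.of ((h.η.app (op A)).hom e') =
      Algebra.GrothendieckGroup.of z * Algebra.GrothendieckGroup.of ((h.η.app (op A)).hom e) := by
    rw [← map_mul, ← map_mul, hzz]
  set a := Algebra.GrothendieckGroup.of ((h.η.app (op A)).hom e)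
  set b := Algebra.GrothendieckGroup.of ((h.η.app (op A)).hom e')
  have key : a * b * (Algebra.GrothendieckGroup.of c * Algebra.GrothendieckGroup.of z') =
      a * b * (Algebra.GrothendieckGroup.of c' * Algebra.GrothendieckGroup.of z) := by
    calc a * b * (Algebra.GrothendieckGroup.of c * Algebra.GrothendieckGroup.of z')
        = (a * Algebra.GrothendieckGroup.of c) * (Algebra.GrothendieckGroup.of z' * b) := by ac_rfl
      _ = (b * Algebra.GrothendieckGroup.of c') * (Algebra.GrothendieckGroup.of z * a) := by rw [A1, A2]
      _ = a * b * (Algebra.GrothendieckGroup.of c' * Algebra.GrothendieckGroup.of z) := by ac_rfl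
  exact mul_left_cancel key

/-- **(c5) Powers of the unit coordinate.** Under the hypotheses of (c4): for an identity-base linear
`k = (1, 𝟙, z, u) : G(A, γ) → G(A, γ')` with `Div(ρ k) = ẑ` and every `n ≥ 1` there is an identity-base linear
`K_n : G(A, γ) → G(A, t_n)` with unit coordinate `u^n`, `Div(K_n) = z_n`, `Div(ρ K_n) = ẑ_n` and
`ẑ_n - z_n = n · (ẑ - z)` in `Φ'(A)^gp` (compose `K_n` with the translate `(1, 𝟙, z, u) : G(A, t_n) → G(A, t_n + γ' - γ)`
of `k`, whose image has `Div = ẑ` by (c4), and use (c1)). [cite: MochizukiFrdI2008, Cor. 5.4 p.104] -/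
theorem exists_pow_unit
    (ρ : ∀ ⦃a a' : ModelFrobenioid Φ B DivB⦄,
      (h.functor.obj a ⟶ h.functor.obj a') → (h.functor.obj a ⟶ h.functor.obj a'))
    (hcomp : ∀ ⦃a a' a'' : ModelFrobenioid Φ B DivB⦄ (k : h.functor.obj a ⟶ h.functor.obj a')
      (l : h.functor.obj a' ⟶ h.functor.obj a''), ρ (k ≫ l) = ρ k ≫ ρ l)
    (hmap : ∀ ⦃a a' : ModelFrobenioid Φ B DivB⦄ (f : a ⟶ a'), ρ (h.functor.map f) = h.functor.map f)
    (A : D) [IsRightCancelMul (Φ'.obj (op A))] (hι : Function.Injective (gpApp h.η (op A)))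
    (hB1 : ∀ (γ γ' : Algebra.GrothendieckGroup (Φ.obj (op A)))
      (k : h.functor.obj ⟨A, γ⟩ ⟶ h.functor.obj ⟨A, γ'⟩), degFr k = 1 → baseMap k = 𝟙 A →
        degFr (ρ k) = 1 ∧ baseMap (ρ k) = 𝟙 A)
    (γ γ' : Algebra.GrothendieckGroup (Φ.obj (op A))) (k : h.functor.obj ⟨A, γ⟩ ⟶ h.functor.obj ⟨A, γ'⟩)
    (z : Φ'.obj (op A)) (uu : B'.obj (op A))
    (hd : degFr k = 1) (hb : baseMap k = 𝟙 A) (hz : div k = z) (hu : unit k = uu)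
    (c : Φ'.obj (op A)) (hc : div (ρ k) = c) (n : ℕ) (hn : 1 ≤ n) :
    ∃ (t : Algebra.GrothendieckGroup (Φ.obj (op A))) (K : h.functor.obj ⟨A, γ⟩ ⟶ h.functor.obj ⟨A, t⟩)
      (zK cK : Φ'.obj (op A)),
      degFr K = 1 ∧ baseMap K = 𝟙 A ∧ div K = zK ∧ unit K = uu ^ n ∧ div (ρ K) = cK ∧
      Algebra.GrothendieckGroup.of cK * Algebra.GrothendieckGroup.of z ^ n =
        Algebra.GrothendieckGroup.of c ^ n * Algebra.GrothendieckGroup.of zK := by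
  obtain ⟨d, f, z₁, u₁, hrel⟩ := k
  change ℕ+ at d
  change A ⟶ A at f
  change ↥(Φ'.obj (op A)) at z₁
  change ↥(B'.obj (op A)) at u₁
  change d = 1 at hd
  change f = 𝟙 A at hb
  change z₁ = z at hz
  change u₁ = uu at hu
  subst hd hb hz hu
  have hr : (gpApp h.η (op A) γ) ^ ((1 : ℕ+) : ℕ) * Algebra.GrothendieckGroup.of z₁ =
      pullGp Φ' (𝟙 A) (gpApp h.η (op A) γ') * divB Φ' B' DivB' (op A) u₁ := hrel
  rw [PNat.one_coe, pow_one, pullGp_id] at hr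
  have hzu : gpApp h.η (op A) (γ⁻¹ * γ') * divB Φ' B' DivB' (op A) u₁ = Algebra.GrothendieckGroup.of z₁ := by
    rw [map_mul, map_inv, mul_assoc]; exact (eq_inv_mul_of_mul_eq hr).symm
  set k₀ : h.functor.obj ⟨A, γ⟩ ⟶ h.functor.obj ⟨A, γ'⟩ :=
    (⟨1, 𝟙 A, z₁, u₁, hrel⟩ : h.functor.obj ⟨A, γ⟩ ⟶ h.functor.obj ⟨A, γ'⟩) with hk₀
  induction n, hn using Nat.le_induction with
  | base =>
    exact ⟨γ', k₀, z₁, c, rfl, rfl, rfl, by rw [pow_one], hc, by rw [pow_one, pow_one, mul_comm]⟩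
  | succ n hn ih =>
    obtain ⟨t, K, zK, cK, hKd, hKb, hKz, hKu, hKc, hid⟩ := ih
    let kt : h.functor.obj ⟨A, t⟩ ⟶ h.functor.obj ⟨A, t * (γ⁻¹ * γ')⟩ :=
      ⟨1, 𝟙 A, z₁, u₁, by
        show (gpApp h.η (op A) t) ^ ((1 : ℕ+) : ℕ) * Algebra.GrothendieckGroup.of z₁ =
          pullGp Φ' (𝟙 A) (gpApp h.η (op A) (t * (γ⁻¹ * γ'))) * divB Φ' B' DivB' (op A) u₁
        rw [PNat.one_coe, pow_one, pullGp_id, map_mul, mul_assoc, hzu]⟩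
    obtain ⟨hρKd, hρKb⟩ := hB1 _ _ K hKd hKb
    obtain ⟨hρtd, hρtb⟩ := hB1 _ _ kt rfl rfl
    have hct : div (ρ kt) = c :=
      h.div_rho_eq_of_div_eq_of_unit_eq ρ hcomp hmap A hι hB1 _ _ _ _ kt k₀ z₁ u₁ rfl rfl rfl rfl rfl rfl rfl rfl
        (show Φ'.obj (op A) from div (ρ kt)) c rfl hc
    obtain ⟨⟨hK'd, hK'b, hK'z, hK'u⟩, ⟨-, -, hρK'z, -⟩⟩ := h.rho_comp_linear ρ hcomp A γ t _ K kt zK z₁ cK c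
      (u₁ ^ n) u₁ (show B'.obj (op A) from unit (ρ K)) (show B'.obj (op A) from unit (ρ kt))
      hKd hKb hKz hKu rfl rfl rfl rfl hρKd hρKb hKc rfl hρtd hρtb hct rfl
    refine ⟨t * (γ⁻¹ * γ'), K ≫ kt, z₁ * zK, c * cK, hK'd, hK'b, hK'z, ?_, hρK'z, ?_⟩
    · rw [hK'u, pow_succ']
    · rw [map_mul, map_mul, pow_succ', pow_succ']
      calc Algebra.GrothendieckGroup.of c * Algebra.GrothendieckGroup.of cK *
            (Algebra.GrothendieckGroup.of z₁ * Algebra.GrothendieckGroup.of z₁ ^ n)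
          = Algebra.GrothendieckGroup.of c * Algebra.GrothendieckGroup.of z₁ *
            (Algebra.GrothendieckGroup.of cK * Algebra.GrothendieckGroup.of z₁ ^ n) := by ac_rfl
        _ = Algebra.GrothendieckGroup.of c * Algebra.GrothendieckGroup.of z₁ *
            (Algebra.GrothendieckGroup.of c ^ n * Algebra.GrothendieckGroup.of zK) := by rw [hid]
        _ = Algebra.GrothendieckGroup.of c * Algebra.GrothendieckGroup.of c ^ n *
            (Algebra.GrothendieckGroup.of z₁ * Algebra.GrothendieckGroup.of zK) := by ac_rfl

end ModelFrobenioid.DataHom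
end Literature.AlgebraicGeometry.Frobenioids
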